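import Summits.QuantumFields.BalabanUV.T4Continuum.Support.NE7SliceIterationStateNL0
import HarnessLib

/-!
# NE7SliceIterationStateFactsNL0 — THE STATE MAPS OF THE (S1) ITERATION ON THE NONLINEAR FRAME TARGET WITH THE FRAME-FREE RIGHT INVERSE, ON THE WORKING REGION (memo ROAD-G103 §6,
# repair (R1″), file (C1)-2): VERBATIM `NE7SliceIterationStateFactsNL` §3–§4 with `rightInvW ↦ NE7FrameFreeRightInverse.rightInvW0`

Cell `pub-balaban`, rung (B)+1 sub-cell t4, lineage `b2b-balaban-t4-ne7-p1`, generation 103 (CRUX PROVER NE7 #1 = OWNER of BINDER row NE7).  Memo `t4/b2b-balaban-t4-ne7-p1-g103/ROAD-G103.md` §6.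
The facts about `P(u)`, `h̃(u)`, `φ̃(u)` (`frameDefect_skew∕periodic`, `norm_frameDefect_le`, `effCornerLog_skew∕periodic`, `coarseDatumNL_skew_periodic`, …) are those of
`NE7SliceIterationStateFactsNL` (REUSED BY NAME — they do not see the right inverse); re-issued here for the NL0 maps: `T̃(u)` skew periodic with `dirIter T̃(u) = gaugeDir_V h̃(u)`
(`dirIter_rightInvW0` is exact), the normalised split of `(T̃(u), h̃(u))` EXISTS, and the access letters `‖framePotW T̃(u) − h̃(u)‖ ≤ m̃(u)`, `‖gaugeDir W ζ̃(u)‖ ≤ δ̃(u)`, `‖ζ̃(u)‖ ≤ 6dM·D̃f(u)`.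
Displayed regime: B7's Prop-4 hypotheses for `W` and `U′` at level `k+1` (as in the NL file) and the squared-tent line `hE`.
WHAT ([folklore]; 0 def, 0 sorry).  `tangentPartNL0_skew`, `tangentPartNL0_periodic`, `dirIter_tangentPartNL0`, `splitNL0_exists`, `splitNL0_holds`, `frameNL0_periodic`, `norm_frame_le_frameMismatchNL0`,
`norm_gaugeDir_gaugeFunNL0_le`, `delta_le_sliceDefectNL0`, `norm_gaugeFunNL0_le`.
HONEST FRAMING (page 1): kinematics∕bookkeeping at ONE background over landed kernel theorems; nothing of Bałaban's asserted; NOT (S1), NOT NE7; spine 0∕9; finite T⁴ rung (B)+1 — NOT infinite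
volume, NOT mass gap, NOT BetaPertH, NOT Clay.  Continuum YM on T⁴ ⇐ BetaPertH ∧ nine spine estimates (0/9 proved); BetaPertH ⇐ (D1) ∧ (D4) ∧ CAP+tail; G-an2-4 gates asym, D1 and NE2/3/4.
-/

set_option autoImplicit false

open scoped BigOperators Matrix.Norms.L2Operator
open NormedSpace Finset

namespace Summit.QuantumFields.BalabanUV.T4Continuum.NE7SliceIterationStateFactsNL0

open Literature.MathematicalPhysics.QuantumFieldTheory.Balaban1983to89
open B7Prop1Explicit B7Prop2Explicit B7Prop3Flat MatrixLog
open B7Eq92Concrete (vcov)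
open B7AvgGaugeCovariance (pdev_gaugeAct)
open T4AveragingDeficitWall (IsUnitaryCfg IsSkewDir SmallField vary)
open T4AveragingDeficitWallBoundary (IsPeriodicCfg periodBox)
open T4TermwiseUN (mlog_skew)
open AveragingDeficitPeriodicCounting (IsPeriodicDir)
open AveragingDeficitTwoLevelPrep (prop1Radius)
open AveragingDeficitMultiLevelPrep (cavgIter LevelSmall tower isPeriodicCfg_cavgIter cavgIter_unitary_small)
open AveragingDeficitTransport (mem_U1_of_unitary Ad_mem_skewAdjoint)
open AveragingDeficitKDatum (isUnitaryCfg_gaugeAct)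
open BlockAveragePushDirGauge (gaugeDir isPeriodicDir_gaugeDir)
open BlockAverageCurrent (smallField_gaugeAct)
open NE3EnergyShapes (IsUnitarySite IsPeriodicSite)
open NE3TangentCovariantTower (dirIter framePotW)
open NE3ResidualSliceRep (dirIter_sub isPeriodicCfg_gaugeAct)
open NE3CovariantBlockMean (bmeanIterW)
open NE3QbarIterCovLiftPrep (cruxC)
open NE7FrameFreeRightInverse (rightInvW0 dirIter_rightInvW0 isSkewDir_rightInvW0 isPeriodicDir_rightInvW0)
open NE7SliceIterationStateFactsNL (relPert_repLog_eq relPert_repLog_mem_unitary relPert_repLog_periodic pdev_relPert_mul_le frameDefect_skew frameDefect_periodic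
  norm_frameDefect_le effCornerLog_skew effCornerLog_periodic norm_effCornerLog_le coarseDatumNL_skew_periodic)
open NE3SmoothLiftW (framePotW_add_period)
open NE3FramePotBoundW (tower_eq_pow_mul)
open NE3LandauOrbit (gaugeDir_skew)
open NE3CurvedFrameKill (framePotW_skew_periodic)
open NE7TangentTransportGauge (dirIter_skew_periodic)
open NE7MeanZeroGaugeSliceW (energyBlockLandauW)
open NE7SliceGaugeFunctionSized (exists_fullGauge_split_sized)
open NE7GaugeFunctionSupLetter (sup_le_of_bmeanIterW_le)
open SpreadLift (loopRad)
open NE3.PairLandauB8Avg (relPert relPert_mul_eq_vary)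
open NE3.QbarDictionary (adField relPert_eq_expCfg_adField)
open NE3.FrameNormalisationAdmissibleTop (vcov_add_period vcov_mem_unitaryUnits)
open NE7FrameDefectLipschitz (norm_vcov_relPert_sub_one_le)
open NE7AccumulatedFrameLinearisation (norm_mlog_vcov_sub_framePotW_le)
open NE7SliceIterationState
open NE7SliceIterationStateFacts (repLog_skew repLog_periodic cornerLog_skew cornerLog_periodic)
open NE7SliceIterationStateNL0
open NE7SliceIterationStateNL (frameDefect effCornerLog coarseDatumNL coarseDatumNL_eq effCornerLog_add_frameDefect)

noncomputable section

variable {d : ℕ} {n : Type*} [Fintype n] [DecidableEq n]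

section Facts

variable [Nonempty n] {L : ℕ} (hL : 2 ≤ L) (k : ℕ) {W : Site d → Fin d → (Matrix n n ℂ)ˣ} {x : ℝ} (hWu : IsUnitaryCfg W) (hx : 0 ≤ x) (hs : LevelSmall d L k x)
  (hWx : SmallField W x) (N : ℕ) [NeZero N] (hθ : cruxC d L * (((L : ℝ) ^ (k + 1)) ^ 2 * x) < 1)
  (hE : 4 * (d : ℝ) ^ 2 * ((L : ℝ) ^ (k + 1) - 1) ^ 2 * x + 16 * d * loopRad d L ((prop1Radius d L)^[k] x) ≤ 1 / 2) (U' : Site d → Fin d → (Matrix n n ℂ)ˣ)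
  (hWP : IsPeriodicCfg W ((tower L N (k + 1) : ℕ) : ℤ)) (hU'u : IsUnitaryCfg U') (hU'P : IsPeriodicCfg U' ((tower L N (k + 1) : ℕ) : ℤ))
  {u : Site d → (Matrix n n ℂ)ˣ} (hu : IsUnitarySite u) (huP : IsPeriodicSite u ((tower L N (k + 1) : ℕ) : ℤ))
  (hgauge : gaugeAct u U' = vary W (repLog W U' u) 1) (hXs : ∀ y κ, ‖repLog W U' u y κ‖ ≤ 1 / 8)
  (hcorner : ∀ z, ((u (((L : ℤ) ^ (k + 1)) • z) : (Matrix n n ℂ)ˣ) : Matrix n n ℂ) = exp (cornerLog L k u z)) (hhs : ∀ z, ‖cornerLog L k u z‖ ≤ 1 / 8)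
  -- B7's Prop-4 regime at level `k+1` for `W` and `U′`, and the (−1)-size sup bound of the chart field (for the facts about `P(u)`)
  (hd : 1 ≤ d) {α₀ αP x' b : ℝ} (hα : 0 < α₀) (hα3 : C0 d * α₀ ≤ 1 / 3) (hα4 : 4 * α₀ ≤ c2' d L) (h52 : pdev W < α₀ * (((L : ℝ) ^ (k + 1))⁻¹) ^ 2)
  (hb : 0 ≤ b) (hXb : ∀ y κ, ‖repLog W U' u y κ‖ ≤ b)
  (hsmall : Real.exp (4 * (800 * ((d : ℝ) + 1) ^ 2 * ((d : ℝ) + 4)) * α₀) * (1 + 8 * (131072 * ((d : ℝ) + 1) ^ 2) * ((L : ℝ) ^ (k + 1) * b)) ≤ 2)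
  (hc₃ : 2 * ((L : ℝ) ^ (k + 1) * b) ≤ c3 d L) (h100 : 100 * ((d : ℝ) * L * ((L : ℝ) ^ (k + 1) * b)) ≤ 1)
  (hC16 : 16 * (131072 * ((d : ℝ) + 1) ^ 2) * ((L : ℝ) ^ (k + 1) * b) ≤ 1) (hsm : 2048 * (d : ℝ) * ((L : ℝ) ^ (k + 1) * b) ≤ 1)
  (hαP : 0 < αP) (hαP3 : C0 d * αP ≤ 1 / 3) (hαP2 : 2 * αP ≤ c2' d L) (hx' : 0 ≤ x') (hU'x : SmallField U' x') (hx'P : x' < αP * (((L : ℝ) ^ (k + 1))⁻¹) ^ 2)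

/-! ## §1 The frame defect `P(u)` and the effective corner logs `h̃(u)` -/

include hWP hU'u hU'P hu huP hgauge hXs hcorner hhs hd hα hα3 hα4 h52 hb hXb hsmall hc₃ hsm hαP hαP3 hαP2 hx' hU'x hx'P in
/-- **`T̃(u)` IS SKEW** on the working region. [folklore] -/
theorem tangentPartNL0_skew : IsSkewDir (tangentPartNL0 hL k hWu hx hs hWx N hθ hE U' u) := by
  have hφ := (coarseDatumNL_skew_periodic hL k hWu hx hs hWx N U' hWP hU'u hU'P hu huP hgauge hXs hcorner hhs hd hα hα3 hα4 h52 hb hXb hsmall hc₃ hsm hαP hαP3 hαP2 hx' hU'x hx'P).1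
  intro y κ
  simp only [tangentPartNL0, normalPartNL0_eq hL k hWu hx hs hWx N hθ hE U' hφ]
  exact (skewAdjoint _).sub_mem (repLog_skew hWu U' hU'u hu hgauge hXs y κ) (isSkewDir_rightInvW0 hL k hWu hx hs hWx N hθ hE hφ y κ)

include hWP hU'u hU'P hu huP hgauge hXs hcorner hhs hd hα hα3 hα4 h52 hb hXb hsmall hc₃ hsm hαP hαP3 hαP2 hx' hU'x hx'P in
/-- **`T̃(u)` IS `(tower)`-PERIODIC** on the working region. [folklore] -/
theorem tangentPartNL0_periodic : IsPeriodicDir (tangentPartNL0 hL k hWu hx hs hWx N hθ hE U' u) ((tower L N (k + 1) : ℕ) : ℤ) := by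
  have hφ := (coarseDatumNL_skew_periodic hL k hWu hx hs hWx N U' hWP hU'u hU'P hu huP hgauge hXs hcorner hhs hd hα hα3 hα4 h52 hb hXb hsmall hc₃ hsm hαP hαP3 hαP2 hx' hU'x hx'P).1
  intro y i μ
  simp only [tangentPartNL0, normalPartNL0_eq hL k hWu hx hs hWx N hθ hE U' hφ, repLog_periodic k N U' hWP hU'P huP y i μ,
    isPeriodicDir_rightInvW0 hL k hWu hx hs hWx N hθ hE hφ hWP y i μ]

include hWP hU'u hU'P hu huP hgauge hXs hcorner hhs hd hα hα3 hα4 h52 hb hXb hsmall hc₃ hsm hαP hαP3 hαP2 hx' hU'x hx'P in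
/-- **`dirIter T̃(u) = gaugeDir_V h̃(u)`** on the working region (`rightInvW0` is an exact right inverse). [folklore] -/
theorem dirIter_tangentPartNL0 :
    dirIter L (k + 1) W (tangentPartNL0 hL k hWu hx hs hWx N hθ hE U' u) = gaugeDir (cavgIter L (k + 1) W) (effCornerLog L k W U' u) := by
  have hL1 : 1 ≤ L := by omega
  have hφ := coarseDatumNL_skew_periodic hL k hWu hx hs hWx N U' hWP hU'u hU'P hu huP hgauge hXs hcorner hhs hd hα hα3 hα4 h52 hb hXb hsmall hc₃ hsm hαP hαP3 hαP2 hx' hU'x hx'P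
  have e : tangentPartNL0 hL k hWu hx hs hWx N hθ hE U' u = fun y κ => repLog W U' u y κ - rightInvW0 hL k hWu hx hs hWx N hθ hE hφ.1 y κ := by
    funext y κ; simp only [tangentPartNL0, normalPartNL0_eq hL k hWu hx hs hWx N hθ hE U' hφ.1]
  rw [e, dirIter_sub hL1 k hWu hx hs hWx, dirIter_rightInvW0 hL k hWu hx hs hWx N hθ hE hφ.1 hWP hφ.2 ⟨0, hd⟩]
  funext z κ
  simp only [coarseDatumNL, sub_sub_cancel]

include hWP hU'u hU'P hu huP hgauge hXs hcorner hhs hd hα hα3 hα4 h52 hb hXb hsmall hc₃ hsm hαP hαP3 hαP2 hx' hU'x hx'P in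
/-- **THE NORMALISED SPLIT OF `(T̃(u), h̃(u))` EXISTS** on the working region. [folklore] -/
theorem splitNL0_exists : ∃ p : (Site d → Matrix n n ℂ) × (Site d → Fin d → Matrix n n ℂ),
    IsNormalisedSplit L k N W (tangentPartNL0 hL k hWu hx hs hWx N hθ hE U' u) (effCornerLog L k W U' u) p.1 p.2 := by
  obtain ⟨ζ, Y, hζs, hζP, hY, hsplit, hmean, -⟩ := exists_fullGauge_split_sized hL k hWu hWP hx hs hWx
    (tangentPartNL0_skew hL k hWu hx hs hWx N hθ hE U' hWP hU'u hU'P hu huP hgauge hXs hcorner hhs hd hα hα3 hα4 h52 hb hXb hsmall hc₃ hsm hαP hαP3 hαP2 hx' hU'x hx'P)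
    (tangentPartNL0_periodic hL k hWu hx hs hWx N hθ hE U' hWP hU'u hU'P hu huP hgauge hXs hcorner hhs hd hα hα3 hα4 h52 hb hXb hsmall hc₃ hsm hαP hαP3 hαP2 hx' hU'x hx'P)
    (effCornerLog_skew hL k hWu hx hs hWx N U' hWP hU'u hU'P hu huP hgauge hXs hcorner hhs hd hα hα3 hα4 h52 hb hXb hsmall hc₃ hsm hαP hαP3 hαP2 hx' hU'x hx'P)
    (effCornerLog_periodic hL k hWu hx hs hWx N U' hWP hU'u hU'P hu huP hgauge hXs)
    (dirIter_tangentPartNL0 hL k hWu hx hs hWx N hθ hE U' hWP hU'u hU'P hu huP hgauge hXs hcorner hhs hd hα hα3 hα4 h52 hb hXb hsmall hc₃ hsm hαP hαP3 hαP2 hx' hU'x hx'P)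
  exact ⟨(ζ, Y), hζs, hζP, hY, hsplit, hmean⟩

include hWP hU'u hU'P hu huP hgauge hXs hcorner hhs hd hα hα3 hα4 h52 hb hXb hsmall hc₃ hsm hαP hαP3 hαP2 hx' hU'x hx'P in
/-- the chosen `(ζ̃(u), Ỹ(u))` IS a normalised split of `(T̃(u), h̃(u))` on the working region. [folklore] -/
theorem splitNL0_holds : IsNormalisedSplit L k N W (tangentPartNL0 hL k hWu hx hs hWx N hθ hE U' u) (effCornerLog L k W U' u)
    (gaugeFunNL0 hL k hWu hx hs hWx N hθ hE U' u) (slicePartNL0 hL k hWu hx hs hWx N hθ hE U' u) :=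
  splitNL0_spec hL k hWu hx hs hWx N hθ hE U'
    (splitNL0_exists hL k hWu hx hs hWx N hθ hE U' hWP hU'u hU'P hu huP hgauge hXs hcorner hhs hd hα hα3 hα4 h52 hb hXb hsmall hc₃ hsm hαP hαP3 hαP2 hx' hU'x hx'P)

include hWP hU'u hU'P hu huP hgauge hXs hcorner hhs hd hα hα3 hα4 h52 hb hXb hsmall hc₃ hsm hαP hαP3 hαP2 hx' hU'x hx'P in
/-- the mismatch integrand `z ↦ framePotW T̃(u) z − h̃(u) z` is `N`-periodic on the working region. [folklore] -/
theorem frameNL0_periodic (z : Site d) (i : Fin d) :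
    framePotW L (k + 1) W (tangentPartNL0 hL k hWu hx hs hWx N hθ hE U' u) (z + (N : ℤ) • e i) - effCornerLog L k W U' u (z + (N : ℤ) • e i)
      = framePotW L (k + 1) W (tangentPartNL0 hL k hWu hx hs hWx N hθ hE U' u) z - effCornerLog L k W U' u z := by
  rw [framePotW_add_period L k hWP (tangentPartNL0_periodic hL k hWu hx hs hWx N hθ hE U' hWP hU'u hU'P hu huP hgauge hXs hcorner hhs hd hα hα3 hα4 h52 hb hXb hsmall hc₃ hsm hαP hαP3
    hαP2 hx' hU'x hx'P) z i, effCornerLog_periodic hL k hWu hx hs hWx N U' hWP hU'u hU'P hu huP hgauge hXs z i]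

include hWP hU'u hU'P hu huP hgauge hXs hcorner hhs hd hα hα3 hα4 h52 hb hXb hsmall hc₃ hsm hαP hαP3 hαP2 hx' hU'x hx'P in
/-- **`‖framePotW T̃(u) z − h̃(u) z‖ ≤ m̃(u)`** everywhere. [folklore] -/
theorem norm_frame_le_frameMismatchNL0 (z : Site d) :
    ‖framePotW L (k + 1) W (tangentPartNL0 hL k hWu hx hs hWx N hθ hE U' u) z - effCornerLog L k W U' u z‖ ≤ frameMismatchNL0 hL k hWu hx hs hWx N hθ hE U' u :=
  le_siteSup (Nat.one_le_iff_ne_zero.mpr (NeZero.ne N)) (f := fun z => ‖framePotW L (k + 1) W (tangentPartNL0 hL k hWu hx hs hWx N hθ hE U' u) z - effCornerLog L k W U' u z‖)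
    (fun x κ => by simp only [frameNL0_periodic hL k hWu hx hs hWx N hθ hE U' hWP hU'u hU'P hu huP hgauge hXs hcorner hhs hd hα hα3 hα4 h52 hb hXb hsmall hc₃ hsm hαP hαP3 hαP2 hx' hU'x hx'P x κ]) z

include hWP hU'u hU'P hu huP hgauge hXs hcorner hhs hd hα hα3 hα4 h52 hb hXb hsmall hc₃ hsm hαP hαP3 hαP2 hx' hU'x hx'P in
/-- **`‖gaugeDir W ζ̃(u) y μ‖ ≤ δ̃(u)`** everywhere. [folklore] -/
theorem norm_gaugeDir_gaugeFunNL0_le (y : Site d) (μ : Fin d) :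
    ‖gaugeDir W (gaugeFunNL0 hL k hWu hx hs hWx N hθ hE U' u) y μ‖
      ≤ bondSup (tower L N (k + 1)) (fun y μ => ‖gaugeDir W (gaugeFunNL0 hL k hWu hx hs hWx N hθ hE U' u) y μ‖) := by
  haveI : NeZero L := ⟨by omega⟩
  have hsp := splitNL0_holds hL k hWu hx hs hWx N hθ hE U' hWP hU'u hU'P hu huP hgauge hXs hcorner hhs hd hα hα3 hα4 h52 hb hXb hsmall hc₃ hsm hαP hαP3 hαP2 hx' hU'x hx'P
  have hP := isPeriodicDir_gaugeDir hWP hsp.2.1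
  exact le_bondSup (Nat.one_le_iff_ne_zero.mpr (NeZero.ne _)) (F := fun y μ => ‖gaugeDir W (gaugeFunNL0 hL k hWu hx hs hWx N hθ hE U' u) y μ‖)
    (fun x κ μ => by simp only [hP x κ μ]) y μ

/-- `m̃(u) ≤ M·D̃f(u)` (`δ̃(u) ≥ 0`, `L ≥ 2`; NE7b's `NE7SliceTangentPartLimitNL.frameMismatchNL_le_sliceDefectNL` for the NL0 maps). [folklore] -/
theorem frameMismatchNL0_le_sliceDefectNL0 (u : Site d → (Matrix n n ℂ)ˣ) :
    frameMismatchNL0 hL k hWu hx hs hWx N hθ hE U' u ≤ (L : ℝ) ^ (k + 1) * sliceDefectNL0 hL k hWu hx hs hWx N hθ hE U' u := by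
  have hM : 0 < (L : ℝ) ^ (k + 1) := pow_pos (by exact_mod_cast (by omega : 0 < L)) _
  have e : (L : ℝ) ^ (k + 1) * sliceDefectNL0 hL k hWu hx hs hWx N hθ hE U' u
      = (L : ℝ) ^ (k + 1) * bondSup (tower L N (k + 1)) (fun y μ => ‖gaugeDir W (gaugeFunNL0 hL k hWu hx hs hWx N hθ hE U' u) y μ‖)
        + frameMismatchNL0 hL k hWu hx hs hWx N hθ hE U' u := by
    unfold sliceDefectNL0; field_simp
  rw [e]
  exact le_add_of_nonneg_left (mul_nonneg hM.le (bondSup_nonneg fun y μ => norm_nonneg _))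

/-- `δ̃(u) ≤ D̃f(u)`. [folklore] -/
theorem delta_le_sliceDefectNL0 (u : Site d → (Matrix n n ℂ)ˣ) :
    bondSup (tower L N (k + 1)) (fun y μ => ‖gaugeDir W (gaugeFunNL0 hL k hWu hx hs hWx N hθ hE U' u) y μ‖) ≤ sliceDefectNL0 hL k hWu hx hs hWx N hθ hE U' u := by
  have hM : 0 < (L : ℝ) ^ (k + 1) := pow_pos (by exact_mod_cast (by omega : 0 < L)) _
  exact le_add_of_nonneg_right (div_nonneg (siteSup_nonneg fun z => norm_nonneg _) hM.le)

include hWP hU'u hU'P hu huP hgauge hXs hcorner hhs hd hα hα3 hα4 h52 hb hXb hsmall hc₃ hsm hαP hαP3 hαP2 hx' hU'x hx'P in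
/-- **THE GAUGE FUNCTION IS SIZED BY THE DEFECT**: for Poincaré parameter `θ_P ≤ 1∕2`, `‖ζ̃(u) y‖ ≤ 6dM·D̃f(u)`. [folklore] -/
theorem norm_gaugeFunNL0_le
    (hθP : 4 * (d : ℝ) ^ 2 * ((L : ℝ) ^ (k + 1) - 1) ^ 2 * x + 16 * d * loopRad d L ((prop1Radius d L)^[k] x)
        + 4 * d * ((d : ℝ) - 1) * ((L : ℝ) ^ (k + 1) - 1) ^ 2 * x ≤ 1 / 2) (y : Site d) :
    ‖gaugeFunNL0 hL k hWu hx hs hWx N hθ hE U' u y‖ ≤ 6 * d * (L : ℝ) ^ (k + 1) * sliceDefectNL0 hL k hWu hx hs hWx N hθ hE U' u := by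
  have hsp := splitNL0_holds hL k hWu hx hs hWx N hθ hE U' hWP hU'u hU'P hu huP hgauge hXs hcorner hhs hd hα hα3 hα4 h52 hb hXb hsmall hc₃ hsm hαP hαP3 hαP2 hx' hU'x hx'P
  obtain ⟨hζs, hζP, -, -, hmean⟩ := hsp
  have hm : ∀ z, ‖bmeanIterW L (k + 1) W (gaugeFunNL0 hL k hWu hx hs hWx N hθ hE U' u) z‖ ≤ frameMismatchNL0 hL k hWu hx hs hWx N hθ hE U' u := fun z => by
    rw [hmean z, norm_neg]
    exact norm_frame_le_frameMismatchNL0 hL k hWu hx hs hWx N hθ hE U' hWP hU'u hU'P hu huP hgauge hXs hcorner hhs hd hα hα3 hα4 h52 hb hXb hsmall hc₃ hsm hαP hαP3 hαP2 hx' hU'x hx'P z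
  have hG := norm_gaugeDir_gaugeFunNL0_le hL k hWu hx hs hWx N hθ hE U' hWP hU'u hU'P hu huP hgauge hXs hcorner hhs hd hα hα3 hα4 h52 hb hXb hsmall hc₃ hsm hαP hαP3 hαP2 hx' hU'x hx'P
  haveI : NeZero L := ⟨by omega⟩
  have hP1 : 1 ≤ tower L N (k + 1) := Nat.one_le_iff_ne_zero.mpr (NeZero.ne _)
  have h := sup_le_of_bmeanIterW_le hL k hWu hx hs hWx (gaugeFunNL0 hL k hWu hx hs hWx N hθ hE U' u) hm hP1 hζP hG (lt_of_le_of_lt hθP (by norm_num)) y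
  clear hm hG hζs hζP hWP hU'u hU'P hu huP hgauge hXs hcorner hhs hα hα3 hα4 h52 hXb hsmall hc₃ hsm hαP hαP3 hαP2 hU'x hx'P
  refine h.trans ?_
  obtain ⟨θP, hθPdef⟩ : ∃ t : ℝ, t = 4 * (d : ℝ) ^ 2 * ((L : ℝ) ^ (k + 1) - 1) ^ 2 * x + 16 * d * loopRad d L ((prop1Radius d L)^[k] x)
      + 4 * d * ((d : ℝ) - 1) * ((L : ℝ) ^ (k + 1) - 1) ^ 2 * x := ⟨_, rfl⟩
  rw [← hθPdef] at hθP ⊢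
  obtain ⟨M, hMdef⟩ : ∃ M : ℝ, M = (L : ℝ) ^ (k + 1) := ⟨_, rfl⟩
  rw [← hMdef]
  have hM1 : 1 ≤ M := hMdef ▸ one_le_pow₀ (by exact_mod_cast (by omega : 1 ≤ L))
  have hd1 : (1 : ℝ) ≤ d := by exact_mod_cast hd
  have hDf0 : 0 ≤ sliceDefectNL0 hL k hWu hx hs hWx N hθ hE U' u := sliceDefectNL0_nonneg hL k hWu hx hs hWx N hθ hE U' u
  have hδ0 : 0 ≤ bondSup (tower L N (k + 1)) (fun y μ => ‖gaugeDir W (gaugeFunNL0 hL k hWu hx hs hWx N hθ hE U' u) y μ‖) := bondSup_nonneg fun y μ => norm_nonneg _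
  have hδ := delta_le_sliceDefectNL0 hL k hWu hx hs hWx N hθ hE U' u
  have hmM := frameMismatchNL0_le_sliceDefectNL0 hL k hWu hx hs hWx N hθ hE U' u
  rw [← hMdef] at hmM
  have hnum0 : 0 ≤ frameMismatchNL0 hL k hWu hx hs hWx N hθ hE U' u
      + 2 * d * (M - 1) * bondSup (tower L N (k + 1)) (fun y μ => ‖gaugeDir W (gaugeFunNL0 hL k hWu hx hs hWx N hθ hE U' u) y μ‖) := by
    have := siteSup_nonneg (P := N) (fun z => norm_nonneg (framePotW L (k + 1) W (tangentPartNL0 hL k hWu hx hs hWx N hθ hE U' u) z - effCornerLog L k W U' u z))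
    have h2 : 0 ≤ 2 * d * (M - 1) := by nlinarith
    exact add_nonneg this (mul_nonneg h2 hδ0)
  have hden : (1 : ℝ) / 2 ≤ 1 - θP := by linarith
  calc (frameMismatchNL0 hL k hWu hx hs hWx N hθ hE U' u + 2 * d * (M - 1) * bondSup (tower L N (k + 1)) (fun y μ => ‖gaugeDir W (gaugeFunNL0 hL k hWu hx hs hWx N hθ hE U' u) y μ‖)) / (1 - θP)
      ≤ (frameMismatchNL0 hL k hWu hx hs hWx N hθ hE U' u + 2 * d * (M - 1) * bondSup (tower L N (k + 1)) (fun y μ => ‖gaugeDir W (gaugeFunNL0 hL k hWu hx hs hWx N hθ hE U' u) y μ‖)) / (1 / 2) :=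
        div_le_div_of_nonneg_left hnum0 (by norm_num) hden
    _ = 2 * frameMismatchNL0 hL k hWu hx hs hWx N hθ hE U' u
          + 4 * d * (M - 1) * bondSup (tower L N (k + 1)) (fun y μ => ‖gaugeDir W (gaugeFunNL0 hL k hWu hx hs hWx N hθ hE U' u) y μ‖) := by ring
    _ ≤ 2 * (M * sliceDefectNL0 hL k hWu hx hs hWx N hθ hE U' u) + 4 * d * (M - 1) * sliceDefectNL0 hL k hWu hx hs hWx N hθ hE U' u := by
        have h2 : 0 ≤ 4 * d * (M - 1) := by nlinarith
        nlinarith [mul_le_mul_of_nonneg_left hδ h2]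
    _ ≤ 6 * d * M * sliceDefectNL0 hL k hWu hx hs hWx N hθ hE U' u := by
        have h1 : M * sliceDefectNL0 hL k hWu hx hs hWx N hθ hE U' u ≤ d * (M * sliceDefectNL0 hL k hWu hx hs hWx N hθ hE U' u) :=
          le_mul_of_one_le_left (mul_nonneg (by linarith) hDf0) hd1
        have h2 : 4 * d * (M - 1) * sliceDefectNL0 hL k hWu hx hs hWx N hθ hE U' u ≤ 4 * d * M * sliceDefectNL0 hL k hWu hx hs hWx N hθ hE U' u := by
          nlinarith [mul_nonneg (by linarith : (0 : ℝ) ≤ d) hDf0]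
        nlinarith [h1, h2]

end Facts

end

end Summit.QuantumFields.BalabanUV.T4Continuum.NE7SliceIterationStateFactsNL0
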